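import Literature.NumberTheory.Sieve.Maynard2016CoupledEuler
import Literature.NumberTheory.Sieve.PolymathLcmSumsEuler

/-!
# Maynard (2016), Lemma 6: the coupled kernel `∏_p K_p` as an absolutely convergent sum ((6.10))

Trunk: AntSieve / parity (Maynard 2016 large-gaps ladder, named fact
`Literature.NumberTheory.Sieve.Maynard2016.Lemma6MainTerm` of `Maynard2016Lemma6Split.lean`).

Second layer over `Maynard2016CoupledEuler.lean` (the finite coupled Euler product
`LcmEuler.sum_coupled_eq_prod`), parallel to the `K = ∏_{p ∤ W} K_p` layer of the tree's Polymath 8b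
engine (`PolymathLcmSumsEuler.lean`: `eulerTerm`, `eulerKernel`, `tendsto_prod_localFactor`).  In
the proof of Lemma 6 of J. Maynard, *Large gaps between primes*, Ann. of Math. 183 (2016) =
arXiv:1408.5110, §6, after the Fourier expansion (6.9) the main term becomes the integral of the
multiple Dirichlet series (6.10)

  `K = Σ' ∏_ℓ μ(d_ℓ)μ(d'_ℓ)μ(e_ℓ)μ(e'_ℓ) d_ℓ^{-s_ℓ} … (e'_ℓ)^{-r'_ℓ} / [d, d', e, e']`

("Here we have swapped the order of summation and integration (which is valid because the expression
is absolutely convergent)", p. 10), which "we can rewrite … as a product `∏_p K_p`" with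
`K_p = 1 + O_k(p^{-1-1/log x})`, so that "`∏_p K_p ≪ (log x)^{O_k(1)}`".

This file proves these three facts for the coupled terms with Möbius weights
`μ(n) n^{-a}` (exponents `a_i, b_i` on the `d`-side, `a'_j, b'_j` on the `e`-side, all of real part
`≥ σ > 0` — in Lemma 6 the two sides have real parts `1/log x` and `1/log y`; the summation condition `CoupledAdm W m M` = the `[d_i,d'_i]` pairwise coprime and coprime
to `W`, the `[e_j,e'_j]` likewise and coprime to `m`, and a prime dividing `[d_i,d'_i]` and
`[e_j,e'_j]` lies in the coupling set `M p`):
* `LcmEuler.sum_pairBox_coupledEulerTerm` — over the pairs supported on a finite set of primes `P`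
  not dividing `W`, the sum of the terms is `∏_{p ∈ P} K_p` (`coupledLocalFactor` of the Möbius
  weights);
* `LcmEuler.sum_norm_coupledEulerTerm_le` — every finite partial sum of `|terms|` is at most
  `coupledKernelBound k₁ k₂ σ = exp((3k₁ + 3k₂ + 9k₁k₂) Σ_n n^{-1-σ})` (absolute convergence,
  quantitatively; `Σ_n n^{-1-1/log x} ≍ log x` gives Maynard's `(log x)^{O_k(1)}`), whence
  `summable_norm_coupledEulerTerm`, `hasSum_coupledEulerTerm`, `norm_coupledKernel_le`;
* `LcmEuler.tendsto_prod_coupledLocalFactor` — `∏_{p < N, p ∤ W} K_p → K` as `N → ∞`, and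
  `LcmEuler.tendsto_sum_box_coupledEulerTerm` — the sums over the boxes `[1,D]^{2k₁} × [1,D]^{2k₂}`
  tend to `K`.

## References

* J. Maynard, *Large gaps between primes*, Ann. of Math. (2) 183 (2016), 915–933; arXiv:1408.5110,
  §6, proof of Lemma 6, displays (6.9)–(6.11). [Maynard2016LargeGaps]
* D. H. J. Polymath, *Variants of the Selberg sieve, and bounded intervals containing many primes*,
  Res. Math. Sci. 1 (2014), Art. 12; arXiv:1407.4897, proof of Lemma 4.1. [Polymath8b2014]
-/

noncomputable section

open Filter Finset
open scoped BigOperators Topology ArithmeticFunction.Moebius Classical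

namespace Literature.NumberTheory.Sieve

namespace LcmEuler

variable {ι κ : Type*} [Fintype ι] [DecidableEq ι] [Fintype κ] [DecidableEq κ]

/-! ### The terms of the coupled kernel -/

/-- The summation condition `Σ'` of (6.8)/(6.10) on a pair `(tD, tE) = ((d,d'),(e,e'))` of pairs of
tuples: `[d_i,d'_i]` pairwise coprime and coprime to `W`; `[e_j,e'_j]` pairwise coprime, coprime to `W`
and to `m`; a prime dividing both `[d_i,d'_i]` and `[e_j,e'_j]` lies in the coupling set `M p`
(Maynard: `p ∣ m q (h_j − h_i) − 1`). [cite: Maynard2016LargeGaps, §6 display (6.8)] -/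
def CoupledAdm (W m : ℕ) (M : ℕ → Finset (ι × κ)) (tD : (ι → ℕ) × (ι → ℕ))
    (tE : (κ → ℕ) × (κ → ℕ)) : Prop :=
  LcmCoprime W tD.1 tD.2 ∧ LcmCoprime W tE.1 tE.2 ∧
    (∀ j, Nat.Coprime (Nat.lcm (tE.1 j) (tE.2 j)) m) ∧
      ∀ p, p.Prime → ∀ i j, p ∣ Nat.lcm (tD.1 i) (tD.2 i) → p ∣ Nat.lcm (tE.1 j) (tE.2 j) →
        (i, j) ∈ M p

/-- The Möbius–power weight `n ↦ μ(n) n^{-a_i}` of slot `i`. [cite: Maynard2016LargeGaps, §6 display (6.10)] -/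
def moebiusWeight {α : Type*} (a : α → ℂ) (i : α) (n : ℕ) : ℂ := (μ n : ℂ) * (n : ℂ) ^ (-a i)

/-- The term of the coupled kernel (6.10):
`[CoupledAdm] ∏_i μ(d_i)μ(d'_i) d_i^{-a_i} (d'_i)^{-b_i} ∏_j μ(e_j)μ(e'_j) e_j^{-a'_j} (e'_j)^{-b'_j} / [d,d',e,e']`.
[cite: Maynard2016LargeGaps, §6 display (6.10)] -/
def coupledEulerTerm (W m : ℕ) (M : ℕ → Finset (ι × κ)) (a b : ι → ℂ) (a' b' : κ → ℂ)
    (t : ((ι → ℕ) × (ι → ℕ)) × ((κ → ℕ) × (κ → ℕ))) : ℂ :=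
  if CoupledAdm W m M t.1 t.2 then
    coupledSummand (moebiusWeight a) (moebiusWeight b) (moebiusWeight a') (moebiusWeight b') t.1 t.2
  else 0

/-- The coupled kernel `K` of (6.10), as an (absolutely convergent, `summable_norm_coupledEulerTerm`)
sum over all pairs of pairs of tuples. [cite: Maynard2016LargeGaps, §6 display (6.10)] -/
def coupledKernel (W m : ℕ) (M : ℕ → Finset (ι × κ)) (a b : ι → ℂ) (a' b' : κ → ℂ) : ℂ :=
  ∑' t, coupledEulerTerm W m M a b a' b' t

/-- The Euler factor `K_p` of (6.11)–(6.13) for the Möbius–power weights. [cite: Maynard2016LargeGaps, §6 displays (6.11)–(6.13)] -/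
def coupledLocalFactorMu (m : ℕ) (M : ℕ → Finset (ι × κ)) (a b : ι → ℂ) (a' b' : κ → ℂ)
    (q : ℕ) : ℂ :=
  coupledLocalFactor (moebiusWeight a) (moebiusWeight b) (moebiusWeight a') (moebiusWeight b') m M q

omit [Fintype ι] [DecidableEq ι] [Fintype κ] [DecidableEq κ] in
/-- `μ(n) n^{-a}` is multiplicative over products of distinct primes. [folklore] -/
private theorem isPrimeProdMult_moebiusWeight {α : Type*} (a : α → ℂ) (i : α) :
    IsPrimeProdMult (moebiusWeight a i) :=
  isPrimeProdMult_moebius_cpow (a i)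

/-! ### The finite Euler product over pairs supported on `P` -/

omit [Fintype ι] [Fintype κ] in
/-- On pairs supported on primes of `P` not dividing `W`, `CoupledAdm` is pairwise coprimality on both
sides together with the finite cross condition `CrossCond P`. [folklore] -/
private theorem coupledAdm_iff_of_mem_pairBox [Fintype ι] [Fintype κ] {P : Finset ℕ}
    (hP : ∀ q ∈ P, q.Prime) {W : ℕ} (hPW : ∀ q ∈ P, ¬ q ∣ W) (m : ℕ) (M : ℕ → Finset (ι × κ))
    {tD : (ι → ℕ) × (ι → ℕ)} {tE : (κ → ℕ) × (κ → ℕ)} (htD : tD ∈ pairBox ι P)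
    (htE : tE ∈ pairBox κ P) :
    CoupledAdm W m M tD tE ↔
      PairwiseCoprimeLcm tD ∧ PairwiseCoprimeLcm tE ∧ CrossCond P m M tD tE := by
  rw [CoupledAdm, lcmCoprime_iff_of_mem_pairBox hP hPW htD, lcmCoprime_iff_of_mem_pairBox hP hPW htE,
    CrossCond]
  have hmem := htD
  simp only [pairBox, Finset.mem_product, Fintype.mem_piFinset, Nat.mem_divisors] at hmem
  constructor
  · rintro ⟨h1, h2, h3, h4⟩
    exact ⟨h1, h2, h3, fun q hq i j hdi hej => h4 q (hP q hq) i j hdi hej⟩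
  · rintro ⟨h1, h2, h3, h4⟩
    refine ⟨h1, h2, h3, fun p hp i j hdi hej => h4 p ?_ i j hdi hej⟩
    have hdvd : p ∣ ∏ q ∈ P, q := hdi.trans (Nat.lcm_dvd (hmem.1 i).1 (hmem.2 i).1)
    obtain ⟨q, hq, hpq⟩ := (hp.prime.dvd_finsetProd_iff _).1 hdvd
    rwa [(Nat.prime_dvd_prime_iff_eq hp (hP q hq)).1 hpq]

/-- **(6.10) = ∏_p K_p over a finite set of primes**: for a finite set `P` of primes not dividing `W`,
the sum of the coupled terms over the pairs supported on `P` is `∏_{p ∈ P} K_p`.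
[cite: Maynard2016LargeGaps, §6 displays (6.10)–(6.13)] -/
theorem sum_pairBox_coupledEulerTerm {P : Finset ℕ} (hP : ∀ q ∈ P, q.Prime) {W : ℕ}
    (hPW : ∀ q ∈ P, ¬ q ∣ W) (m : ℕ) (M : ℕ → Finset (ι × κ)) (a b : ι → ℂ) (a' b' : κ → ℂ) :
    ∑ tD ∈ pairBox ι P, ∑ tE ∈ pairBox κ P, coupledEulerTerm W m M a b a' b' (tD, tE) =
      ∏ q ∈ P, coupledLocalFactorMu m M a b a' b' q := by
  have h1 : ∑ tD ∈ pairBox ι P, ∑ tE ∈ pairBox κ P, coupledEulerTerm W m M a b a' b' (tD, tE) =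
      ∑ tD ∈ pairBox ι P, ∑ tE ∈ pairBox κ P,
        (if PairwiseCoprimeLcm tD then
          (if PairwiseCoprimeLcm tE then
            (if CrossCond P m M tD tE then
              coupledSummand (moebiusWeight a) (moebiusWeight b) (moebiusWeight a')
                (moebiusWeight b') tD tE else 0) else 0) else 0) := by
    refine Finset.sum_congr rfl fun tD htD => Finset.sum_congr rfl fun tE htE => ?_
    rw [coupledEulerTerm]
    simp only
    rw [if_congr (coupledAdm_iff_of_mem_pairBox hP hPW m M htD htE) rfl rfl]
    by_cases hD : PairwiseCoprimeLcm tD <;> by_cases hE : PairwiseCoprimeLcm tE <;>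
      by_cases hC : CrossCond P m M tD tE <;> simp [hD, hE, hC]
  rw [h1]
  have h2 : ∀ tD ∈ pairBox ι P, ∑ tE ∈ pairBox κ P,
      (if PairwiseCoprimeLcm tD then
        (if PairwiseCoprimeLcm tE then
          (if CrossCond P m M tD tE then
            coupledSummand (moebiusWeight a) (moebiusWeight b) (moebiusWeight a')
              (moebiusWeight b') tD tE else 0) else 0) else 0) =
      if PairwiseCoprimeLcm tD then ∑ tE ∈ (pairBox κ P).filter PairwiseCoprimeLcm,
        (if CrossCond P m M tD tE then
          coupledSummand (moebiusWeight a) (moebiusWeight b) (moebiusWeight a')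
            (moebiusWeight b') tD tE else 0) else 0 := by
    intro tD _
    split_ifs with hD
    · rw [Finset.sum_filter]
    · simp
  rw [Finset.sum_congr rfl h2, ← Finset.sum_filter]
  exact sum_coupled_eq_prod hP _ _ _ _ (isPrimeProdMult_moebiusWeight a)
    (isPrimeProdMult_moebiusWeight b) (isPrimeProdMult_moebiusWeight a')
    (isPrimeProdMult_moebiusWeight b') m M

/-! ### Absolute values -/

/-- The uniform bound `exp((3k₁ + 3k₂ + 9k₁k₂) Σ_n n^{-1-σ})` for all partial sums of the `|terms|`
(Maynard: "`∏_p K_p ≪ (log x)^{O_k(1)}`", as `Σ_n n^{-1-1/log x} ≍ log x`). [cite: Maynard2016LargeGaps, §6 (proof of Lemma 6, after (6.11))] -/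
def coupledKernelBound (k₁ k₂ : ℕ) (σ : ℝ) : ℝ :=
  Real.exp ((3 * k₁ + 3 * k₂ + 9 * k₁ * k₂) * zetaBoundSum σ)

omit [Fintype ι] [DecidableEq ι] [Fintype κ] [DecidableEq κ] in
/-- The uniform bound is positive. [folklore] -/
private theorem coupledKernelBound_pos (k₁ k₂ : ℕ) (σ : ℝ) : 0 < coupledKernelBound k₁ k₂ σ :=
  Real.exp_pos _

/-- The norm weights `n ↦ |g_i(n)|` (as complex numbers). [folklore] -/
def normWeight {α : Type*} (g : α → ℕ → ℂ) (i : α) (n : ℕ) : ℂ := (‖g i n‖ : ℂ)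

omit [DecidableEq ι] [DecidableEq κ] in
/-- `|coupledSummand g h g' h'| = coupledSummand |g| |h| |g'| |h'|` (as a complex number).
[folklore] -/
private theorem ofReal_norm_coupledSummand (g h : ι → ℕ → ℂ) (g' h' : κ → ℕ → ℂ)
    (tD : (ι → ℕ) × (ι → ℕ)) (tE : (κ → ℕ) × (κ → ℕ)) :
    ((‖coupledSummand g h g' h' tD tE‖ : ℝ) : ℂ) =
      coupledSummand (normWeight g) (normWeight h) (normWeight g') (normWeight h') tD tE := by
  rw [coupledSummand, coupledSummand, norm_div, norm_mul, norm_prod, norm_prod, Complex.norm_natCast]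
  simp only [norm_mul, normWeight]
  push_cast
  rfl

omit [Fintype ι] [DecidableEq ι] [Fintype κ] [DecidableEq κ] in
/-- Norm weights are multiplicative over products of distinct primes when the weights are.
[folklore] -/
private theorem isPrimeProdMult_normWeight {α : Type*} {g : α → ℕ → ℂ}
    (hg : ∀ i, IsPrimeProdMult (g i)) (i : α) : IsPrimeProdMult (normWeight g i) :=
  (hg i).norm

omit [Fintype ι] [DecidableEq ι] [Fintype κ] [DecidableEq κ] in
/-- `|μ(q) q^{-a}| ≤ q^{-σ} ≤ 1` at `q ≥ 1` when `Re a ≥ σ ≥ 0`. [folklore] -/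
private theorem norm_moebiusWeight_le {α : Type*} {a : α → ℂ} {σ : ℝ} (hσ : 0 ≤ σ)
    (ha : ∀ i, σ ≤ (a i).re) (i : α) {q : ℕ} (hq : 1 ≤ q) :
    ‖moebiusWeight a i q‖ ≤ (q : ℝ) ^ (-σ) ∧ (q : ℝ) ^ (-σ) ≤ 1 := by
  have h := norm_moebius_mul_cpow_le q (a i)
  have hq1 : (1 : ℝ) ≤ q := by exact_mod_cast hq
  exact ⟨h.trans (Real.rpow_le_rpow_of_exponent_le hq1 (neg_le_neg (ha i))),
    Real.rpow_le_one_of_one_le_of_nonpos hq1 (by linarith)⟩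

omit [Fintype ι] [DecidableEq ι] [Fintype κ] [DecidableEq κ] in
/-- The local term of the norm weights is bounded by `3 q^{-σ}`. [folklore] -/
private theorem norm_slotTerm_normWeight_le {α : Type*} {a b : α → ℂ} {σ : ℝ} (hσ : 0 ≤ σ)
    (ha : ∀ i, σ ≤ (a i).re) (hb : ∀ i, σ ≤ (b i).re) (i : α) {q : ℕ} (hq : 1 ≤ q) :
    ‖slotTerm (normWeight (moebiusWeight a)) (normWeight (moebiusWeight b)) q i‖ ≤
      3 * (q : ℝ) ^ (-σ) := by
  obtain ⟨h1, h1'⟩ := norm_moebiusWeight_le hσ ha i hq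
  obtain ⟨h2, _⟩ := norm_moebiusWeight_le hσ hb i hq
  have h0 : 0 ≤ (q : ℝ) ^ (-σ) := Real.rpow_nonneg (Nat.cast_nonneg q) _
  rw [slotTerm, normWeight, normWeight]
  have e1 : ‖((‖moebiusWeight a i q‖ : ℝ) : ℂ)‖ = ‖moebiusWeight a i q‖ := by
    rw [Complex.norm_real, Real.norm_eq_abs, abs_of_nonneg (norm_nonneg _)]
  have e2 : ‖((‖moebiusWeight b i q‖ : ℝ) : ℂ)‖ = ‖moebiusWeight b i q‖ := by
    rw [Complex.norm_real, Real.norm_eq_abs, abs_of_nonneg (norm_nonneg _)]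
  calc _ ≤ ‖((‖moebiusWeight a i q‖ : ℝ) : ℂ) * ((‖moebiusWeight b i q‖ : ℝ) : ℂ)‖ +
        ‖((‖moebiusWeight a i q‖ : ℝ) : ℂ)‖ + ‖((‖moebiusWeight b i q‖ : ℝ) : ℂ)‖ :=
        (norm_add_le _ _).trans (add_le_add (norm_add_le _ _) le_rfl)
    _ = ‖moebiusWeight a i q‖ * ‖moebiusWeight b i q‖ + ‖moebiusWeight a i q‖ +
        ‖moebiusWeight b i q‖ := by rw [norm_mul, e1, e2]
    _ ≤ (q : ℝ) ^ (-σ) * 1 + (q : ℝ) ^ (-σ) + (q : ℝ) ^ (-σ) := by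
        have hb1 : ‖moebiusWeight b i q‖ ≤ 1 := h2.trans h1'
        gcongr
    _ = 3 * (q : ℝ) ^ (-σ) := by ring

omit [DecidableEq ι] [DecidableEq κ] in
/-- **`K_p = 1 + O_k(p^{-1-σ})` for the absolute local factor**:
`‖K_p(|weights|)‖ ≤ 1 + (3k₁ + 3k₂ + 9k₁k₂) p^{-1-σ} ≤ exp((3k₁ + 3k₂ + 9k₁k₂) p^{-1-σ})`.
[cite: Maynard2016LargeGaps, §6 display (6.11)] -/
theorem norm_coupledLocalFactor_normWeight_le {a b : ι → ℂ} {a' b' : κ → ℂ} {σ : ℝ} (hσ : 0 ≤ σ)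
    (hab : ∀ i, σ ≤ (a i).re ∧ σ ≤ (b i).re) (hab' : ∀ j, σ ≤ (a' j).re ∧ σ ≤ (b' j).re)
    (m : ℕ) (M : ℕ → Finset (ι × κ)) {q : ℕ} (hq : 1 ≤ q) :
    ‖coupledLocalFactor (normWeight (moebiusWeight a)) (normWeight (moebiusWeight b))
        (normWeight (moebiusWeight a')) (normWeight (moebiusWeight b')) m M q‖ ≤
      Real.exp ((3 * Fintype.card ι + 3 * Fintype.card κ + 9 * Fintype.card ι * Fintype.card κ) *
        (q : ℝ) ^ (-(1 + σ))) := by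
  set C : ℝ := 3 * Fintype.card ι + 3 * Fintype.card κ + 9 * Fintype.card ι * Fintype.card κ with hC
  have hq0 : (0 : ℝ) < q := by exact_mod_cast hq
  have hpow0 : 0 ≤ (q : ℝ) ^ (-σ) := Real.rpow_nonneg hq0.le _
  have hpow1 : (q : ℝ) ^ (-σ) ≤ 1 := Real.rpow_le_one_of_one_le_of_nonpos (by exact_mod_cast hq) (by linarith)
  have hA : ∀ i, ‖slotTerm (normWeight (moebiusWeight a)) (normWeight (moebiusWeight b)) q i‖ ≤
      3 * (q : ℝ) ^ (-σ) := fun i => norm_slotTerm_normWeight_le hσ (fun i => (hab i).1) (fun i => (hab i).2) i hq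
  have hB : ∀ j, ‖slotTerm (normWeight (moebiusWeight a')) (normWeight (moebiusWeight b')) q j‖ ≤
      3 * (q : ℝ) ^ (-σ) := fun j => norm_slotTerm_normWeight_le hσ (fun j => (hab' j).1) (fun j => (hab' j).2) j hq
  -- the three pieces
  have hSA : ‖∑ i, slotTerm (normWeight (moebiusWeight a)) (normWeight (moebiusWeight b)) q i‖ ≤
      Fintype.card ι * (3 * (q : ℝ) ^ (-σ)) := by
    refine (norm_sum_le _ _).trans ?_
    calc _ ≤ ∑ _i : ι, 3 * (q : ℝ) ^ (-σ) := Finset.sum_le_sum fun i _ => hA i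
      _ = _ := by rw [Finset.sum_const, Finset.card_univ, nsmul_eq_mul]
  have hSB : ‖∑ j, slotTerm (normWeight (moebiusWeight a')) (normWeight (moebiusWeight b')) q j‖ ≤
      Fintype.card κ * (3 * (q : ℝ) ^ (-σ)) := by
    refine (norm_sum_le _ _).trans ?_
    calc _ ≤ ∑ _j : κ, 3 * (q : ℝ) ^ (-σ) := Finset.sum_le_sum fun j _ => hB j
      _ = _ := by rw [Finset.sum_const, Finset.card_univ, nsmul_eq_mul]
  have hSM : ‖∑ p ∈ M q, slotTerm (normWeight (moebiusWeight a)) (normWeight (moebiusWeight b)) q p.1 *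
      slotTerm (normWeight (moebiusWeight a')) (normWeight (moebiusWeight b')) q p.2‖ ≤
      Fintype.card ι * Fintype.card κ * (9 * (q : ℝ) ^ (-σ)) := by
    refine (norm_sum_le _ _).trans ?_
    have hle : ∀ p ∈ M q, ‖slotTerm (normWeight (moebiusWeight a)) (normWeight (moebiusWeight b)) q p.1 *
        slotTerm (normWeight (moebiusWeight a')) (normWeight (moebiusWeight b')) q p.2‖ ≤
        9 * (q : ℝ) ^ (-σ) := by
      intro p _
      rw [norm_mul]
      calc _ ≤ (3 * (q : ℝ) ^ (-σ)) * (3 * (q : ℝ) ^ (-σ)) :=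
          mul_le_mul (hA p.1) (hB p.2) (norm_nonneg _) (by positivity)
        _ ≤ (3 * (q : ℝ) ^ (-σ)) * (3 * 1) := by gcongr
        _ = 9 * (q : ℝ) ^ (-σ) := by ring
    calc _ ≤ ∑ _p ∈ M q, 9 * (q : ℝ) ^ (-σ) := Finset.sum_le_sum hle
      _ = (M q).card * (9 * (q : ℝ) ^ (-σ)) := by rw [Finset.sum_const, nsmul_eq_mul]
      _ ≤ _ := by
          have hc : ((M q).card : ℝ) ≤ Fintype.card ι * Fintype.card κ := by
            have := Finset.card_le_card (Finset.subset_univ (M q))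
            rw [Finset.card_univ, Fintype.card_prod] at this
            exact_mod_cast this
          gcongr
  -- assemble
  have hX : ‖(∑ i, slotTerm (normWeight (moebiusWeight a)) (normWeight (moebiusWeight b)) q i) +
      (if q ∣ m then 0 else
        (∑ j, slotTerm (normWeight (moebiusWeight a')) (normWeight (moebiusWeight b')) q j) +
        ∑ p ∈ M q, slotTerm (normWeight (moebiusWeight a)) (normWeight (moebiusWeight b)) q p.1 *
          slotTerm (normWeight (moebiusWeight a')) (normWeight (moebiusWeight b')) q p.2)‖ ≤
      C * (q : ℝ) ^ (-σ) := by
    refine (norm_add_le _ _).trans ?_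
    have hite : ‖(if q ∣ m then (0 : ℂ) else
        (∑ j, slotTerm (normWeight (moebiusWeight a')) (normWeight (moebiusWeight b')) q j) +
        ∑ p ∈ M q, slotTerm (normWeight (moebiusWeight a)) (normWeight (moebiusWeight b)) q p.1 *
          slotTerm (normWeight (moebiusWeight a')) (normWeight (moebiusWeight b')) q p.2)‖ ≤
        Fintype.card κ * (3 * (q : ℝ) ^ (-σ)) + Fintype.card ι * Fintype.card κ * (9 * (q : ℝ) ^ (-σ)) := by
      split_ifs
      · rw [norm_zero]; positivity
      · exact (norm_add_le _ _).trans (add_le_add hSB hSM)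
    calc _ ≤ Fintype.card ι * (3 * (q : ℝ) ^ (-σ)) + (Fintype.card κ * (3 * (q : ℝ) ^ (-σ)) +
          Fintype.card ι * Fintype.card κ * (9 * (q : ℝ) ^ (-σ))) := add_le_add hSA hite
      _ = C * (q : ℝ) ^ (-σ) := by rw [hC]; ring
  have hsplit : (q : ℝ) ^ (-(1 + σ)) = (q : ℝ) ^ (-σ) / q := by
    rw [neg_add, Real.rpow_add hq0, Real.rpow_neg_one, mul_comm, div_eq_mul_inv]
  rw [coupledLocalFactor]
  calc _ ≤ ‖(1 : ℂ)‖ + ‖((∑ i, slotTerm (normWeight (moebiusWeight a)) (normWeight (moebiusWeight b)) q i) +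
      (if q ∣ m then 0 else
        (∑ j, slotTerm (normWeight (moebiusWeight a')) (normWeight (moebiusWeight b')) q j) +
        ∑ p ∈ M q, slotTerm (normWeight (moebiusWeight a)) (normWeight (moebiusWeight b)) q p.1 *
          slotTerm (normWeight (moebiusWeight a')) (normWeight (moebiusWeight b')) q p.2)) / (q : ℂ)‖ :=
        norm_add_le _ _
    _ ≤ 1 + C * (q : ℝ) ^ (-σ) / q := by
        rw [norm_one, norm_div, Complex.norm_natCast]
        gcongr
    _ = 1 + C * (q : ℝ) ^ (-(1 + σ)) := by rw [hsplit, mul_div_assoc]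
    _ ≤ Real.exp (C * (q : ℝ) ^ (-(1 + σ))) := by
        rw [add_comm]; exact Real.add_one_le_exp _

/-! ### Support of the terms -/

omit [DecidableEq ι] [DecidableEq κ] in
/-- A non-zero coupled term is admissible with squarefree entries. [folklore] -/
private theorem support_coupledEulerTerm {W m : ℕ} {M : ℕ → Finset (ι × κ)} {a b : ι → ℂ}
    {a' b' : κ → ℂ} {t : ((ι → ℕ) × (ι → ℕ)) × ((κ → ℕ) × (κ → ℕ))}
    (h : coupledEulerTerm W m M a b a' b' t ≠ 0) :
    CoupledAdm W m M t.1 t.2 ∧ (∀ i, Squarefree (t.1.1 i) ∧ Squarefree (t.1.2 i)) ∧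
      ∀ j, Squarefree (t.2.1 j) ∧ Squarefree (t.2.2 j) := by
  unfold coupledEulerTerm at h
  split_ifs at h with hc
  · rw [coupledSummand] at h
    have hnum := (div_ne_zero_iff.1 h).1
    have hD := (mul_ne_zero_iff.1 hnum).1
    have hE := (mul_ne_zero_iff.1 hnum).2
    refine ⟨hc, fun i => ?_, fun j => ?_⟩
    · have hi := Finset.prod_ne_zero_iff.1 hD i (Finset.mem_univ i)
      have h1 : (μ (t.1.1 i) : ℂ) ≠ 0 := by intro h0; apply hi; simp [moebiusWeight, h0]
      have h2 : (μ (t.1.2 i) : ℂ) ≠ 0 := by intro h0; apply hi; simp [moebiusWeight, h0]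
      exact ⟨ArithmeticFunction.moebius_ne_zero_iff_squarefree.1 (by exact_mod_cast h1),
        ArithmeticFunction.moebius_ne_zero_iff_squarefree.1 (by exact_mod_cast h2)⟩
    · have hj := Finset.prod_ne_zero_iff.1 hE j (Finset.mem_univ j)
      have h1 : (μ (t.2.1 j) : ℂ) ≠ 0 := by intro h0; apply hj; simp [moebiusWeight, h0]
      have h2 : (μ (t.2.2 j) : ℂ) ≠ 0 := by intro h0; apply hj; simp [moebiusWeight, h0]
      exact ⟨ArithmeticFunction.moebius_ne_zero_iff_squarefree.1 (by exact_mod_cast h1),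
        ArithmeticFunction.moebius_ne_zero_iff_squarefree.1 (by exact_mod_cast h2)⟩
  · exact absurd rfl h

omit [DecidableEq ι] [DecidableEq κ] in
/-- Non-zero coupled terms are pairs of good pairs (squarefree entries coprime to `W`). [folklore] -/
private theorem goodPair_of_coupledEulerTerm_ne_zero {W m : ℕ} {M : ℕ → Finset (ι × κ)} {a b : ι → ℂ}
    {a' b' : κ → ℂ} {t : ((ι → ℕ) × (ι → ℕ)) × ((κ → ℕ) × (κ → ℕ))}
    (h : coupledEulerTerm W m M a b a' b' t ≠ 0) : GoodPair W t.1 ∧ GoodPair W t.2 := by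
  obtain ⟨hc, hsqD, hsqE⟩ := support_coupledEulerTerm h
  refine ⟨fun i => ⟨(hsqD i).1, (hsqD i).2, ?_, ?_⟩, fun j => ⟨(hsqE j).1, (hsqE j).2, ?_, ?_⟩⟩
  · exact (hc.1.2 i).coprime_dvd_left (Nat.dvd_lcm_left _ _)
  · exact (hc.1.2 i).coprime_dvd_left (Nat.dvd_lcm_right _ _)
  · exact (hc.2.1.2 j).coprime_dvd_left (Nat.dvd_lcm_left _ _)
  · exact (hc.2.1.2 j).coprime_dvd_left (Nat.dvd_lcm_right _ _)

/-! ### Summability and the uniform bound -/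

omit [DecidableEq ι] [DecidableEq κ] in
/-- Pointwise: `|term| ≤` the absolute term (norm weights, same admissibility indicator), as a
complex number of modulus `|term|`. [folklore] -/
private theorem norm_coupledEulerTerm_eq {W m : ℕ} {M : ℕ → Finset (ι × κ)} {a b : ι → ℂ}
    {a' b' : κ → ℂ} (t : ((ι → ℕ) × (ι → ℕ)) × ((κ → ℕ) × (κ → ℕ))) :
    ((‖coupledEulerTerm W m M a b a' b' t‖ : ℝ) : ℂ) =
      if CoupledAdm W m M t.1 t.2 then
        coupledSummand (normWeight (moebiusWeight a)) (normWeight (moebiusWeight b))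
          (normWeight (moebiusWeight a')) (normWeight (moebiusWeight b')) t.1 t.2 else 0 := by
  unfold coupledEulerTerm
  split_ifs with hc
  · exact ofReal_norm_coupledSummand _ _ _ _ _ _
  · simp

/-- **Absolute convergence of the coupled kernel, quantitatively**: every finite partial sum of the
`|terms|` is at most `coupledKernelBound k₁ k₂ σ` ("the expression is absolutely convergent", p. 10;
"`∏_p K_p ≪ (log x)^{O_k(1)}`"). [cite: Maynard2016LargeGaps, §6 (proof of Lemma 6, (6.9)–(6.11))] -/
theorem sum_norm_coupledEulerTerm_le {W m : ℕ} (M : ℕ → Finset (ι × κ)) {a b : ι → ℂ}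
    {a' b' : κ → ℂ} {σ : ℝ} (hσ : 0 < σ) (hab : ∀ i, σ ≤ (a i).re ∧ σ ≤ (b i).re)
    (hab' : ∀ j, σ ≤ (a' j).re ∧ σ ≤ (b' j).re)
    (u : Finset (((ι → ℕ) × (ι → ℕ)) × ((κ → ℕ) × (κ → ℕ)))) :
    ∑ t ∈ u, ‖coupledEulerTerm W m M a b a' b' t‖ ≤
      coupledKernelBound (Fintype.card ι) (Fintype.card κ) σ := by
  -- a bound for the entries occurring in `u`
  set N : ℕ := u.sup (fun t => max (Finset.univ.sup fun i => max (t.1.1 i) (t.1.2 i))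
    (Finset.univ.sup fun j => max (t.2.1 j) (t.2.2 j))) + 1 with hN
  have hNlt : ∀ t ∈ u, (∀ i, t.1.1 i < N ∧ t.1.2 i < N) ∧ ∀ j, t.2.1 j < N ∧ t.2.2 j < N := by
    intro t ht
    have h2 : max (Finset.univ.sup fun i => max (t.1.1 i) (t.1.2 i))
        (Finset.univ.sup fun j => max (t.2.1 j) (t.2.2 j)) ≤
        u.sup (fun t => max (Finset.univ.sup fun i => max (t.1.1 i) (t.1.2 i))
          (Finset.univ.sup fun j => max (t.2.1 j) (t.2.2 j))) :=
      Finset.le_sup (f := fun t => max (Finset.univ.sup fun i => max (t.1.1 i) (t.1.2 i))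
        (Finset.univ.sup fun j => max (t.2.1 j) (t.2.2 j))) ht
    constructor
    · intro i
      have h1 : max (t.1.1 i) (t.1.2 i) ≤ Finset.univ.sup fun i => max (t.1.1 i) (t.1.2 i) :=
        Finset.le_sup (f := fun i => max (t.1.1 i) (t.1.2 i)) (Finset.mem_univ i)
      constructor <;> omega
    · intro j
      have h1 : max (t.2.1 j) (t.2.2 j) ≤ Finset.univ.sup fun j => max (t.2.1 j) (t.2.2 j) :=
        Finset.le_sup (f := fun j => max (t.2.1 j) (t.2.2 j)) (Finset.mem_univ j)
      constructor <;> omega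
  set P := primesBelowNotDvd W N with hPdef
  have hP : ∀ q ∈ P, q.Prime := fun q hq => prime_of_mem_primesBelowNotDvd hq
  have hPW : ∀ q ∈ P, ¬ q ∣ W := fun q hq => not_dvd_of_mem_primesBelowNotDvd hq
  -- Step 1: restrict to the non-zero terms, which lie in `pairBox P × pairBox P`
  have hstep1 : ∑ t ∈ u, ‖coupledEulerTerm W m M a b a' b' t‖ ≤
      ∑ t ∈ pairBox ι P ×ˢ pairBox κ P, ‖coupledEulerTerm W m M a b a' b' t‖ := by
    calc ∑ t ∈ u, ‖coupledEulerTerm W m M a b a' b' t‖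
        = ∑ t ∈ u.filter (fun t => coupledEulerTerm W m M a b a' b' t ≠ 0),
            ‖coupledEulerTerm W m M a b a' b' t‖ := by
          rw [Finset.sum_filter]
          refine Finset.sum_congr rfl fun t _ => ?_
          split_ifs with h
          · rfl
          · rw [not_not.1 h, norm_zero]
      _ ≤ _ := by
          refine Finset.sum_le_sum_of_subset_of_nonneg (fun t ht => ?_) (fun _ _ _ => norm_nonneg _)
          obtain ⟨htu, hne⟩ := Finset.mem_filter.1 ht
          obtain ⟨hg1, hg2⟩ := goodPair_of_coupledEulerTerm_ne_zero hne
          exact Finset.mem_product.2 ⟨mem_pairBox_of_goodPair hg1 (hNlt t htu).1,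
            mem_pairBox_of_goodPair hg2 (hNlt t htu).2⟩
  -- Step 2: the sum over the box, cast to `ℂ`, is the finite absolute Euler product
  have hstep2 : ((∑ t ∈ pairBox ι P ×ˢ pairBox κ P, ‖coupledEulerTerm W m M a b a' b' t‖ : ℝ) : ℂ) =
      ∏ q ∈ P, coupledLocalFactor (normWeight (moebiusWeight a)) (normWeight (moebiusWeight b))
        (normWeight (moebiusWeight a')) (normWeight (moebiusWeight b')) m M q := by
    push_cast
    rw [Finset.sum_congr rfl fun t _ => norm_coupledEulerTerm_eq (W := W) (m := m) (M := M)
      (a := a) (b := b) (a' := a') (b' := b') t, Finset.sum_product]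
    -- same manipulation as in `sum_pairBox_coupledEulerTerm`
    have h2 : ∀ tD ∈ pairBox ι P, ∑ tE ∈ pairBox κ P,
        (if CoupledAdm W m M (tD, tE).1 (tD, tE).2 then
          coupledSummand (normWeight (moebiusWeight a)) (normWeight (moebiusWeight b))
            (normWeight (moebiusWeight a')) (normWeight (moebiusWeight b')) (tD, tE).1 (tD, tE).2
          else 0) =
        if PairwiseCoprimeLcm tD then ∑ tE ∈ (pairBox κ P).filter PairwiseCoprimeLcm,
          (if CrossCond P m M tD tE then
            coupledSummand (normWeight (moebiusWeight a)) (normWeight (moebiusWeight b))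
              (normWeight (moebiusWeight a')) (normWeight (moebiusWeight b')) tD tE else 0) else 0 := by
      intro tD htD
      have h3 : ∀ tE ∈ pairBox κ P,
          (if CoupledAdm W m M (tD, tE).1 (tD, tE).2 then
            coupledSummand (normWeight (moebiusWeight a)) (normWeight (moebiusWeight b))
              (normWeight (moebiusWeight a')) (normWeight (moebiusWeight b')) (tD, tE).1 (tD, tE).2
            else 0) =
          if PairwiseCoprimeLcm tD then
            (if PairwiseCoprimeLcm tE then
              (if CrossCond P m M tD tE then
                coupledSummand (normWeight (moebiusWeight a)) (normWeight (moebiusWeight b))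
                  (normWeight (moebiusWeight a')) (normWeight (moebiusWeight b')) tD tE else 0)
              else 0) else 0 := by
        intro tE htE
        simp only
        rw [if_congr (coupledAdm_iff_of_mem_pairBox hP hPW m M htD htE) rfl rfl]
        by_cases hD : PairwiseCoprimeLcm tD <;> by_cases hE : PairwiseCoprimeLcm tE <;>
          by_cases hC : CrossCond P m M tD tE <;> simp [hD, hE, hC]
      rw [Finset.sum_congr rfl h3]
      split_ifs with hD
      · rw [Finset.sum_filter]
      · simp
    rw [Finset.sum_congr rfl h2, ← Finset.sum_filter]
    exact sum_coupled_eq_prod hP _ _ _ _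
      (isPrimeProdMult_normWeight (isPrimeProdMult_moebiusWeight a))
      (isPrimeProdMult_normWeight (isPrimeProdMult_moebiusWeight b))
      (isPrimeProdMult_normWeight (isPrimeProdMult_moebiusWeight a'))
      (isPrimeProdMult_normWeight (isPrimeProdMult_moebiusWeight b')) m M
  -- Step 3: norms
  have hnonneg : 0 ≤ ∑ t ∈ pairBox ι P ×ˢ pairBox κ P, ‖coupledEulerTerm W m M a b a' b' t‖ :=
    Finset.sum_nonneg fun _ _ => norm_nonneg _
  have hstep3 : ∑ t ∈ pairBox ι P ×ˢ pairBox κ P, ‖coupledEulerTerm W m M a b a' b' t‖ ≤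
      ∏ q ∈ P, Real.exp ((3 * Fintype.card ι + 3 * Fintype.card κ +
        9 * Fintype.card ι * Fintype.card κ) * (q : ℝ) ^ (-(1 + σ))) := by
    have e : ∑ t ∈ pairBox ι P ×ˢ pairBox κ P, ‖coupledEulerTerm W m M a b a' b' t‖ =
        ‖((∑ t ∈ pairBox ι P ×ˢ pairBox κ P, ‖coupledEulerTerm W m M a b a' b' t‖ : ℝ) : ℂ)‖ := by
      rw [Complex.norm_real, Real.norm_eq_abs, abs_of_nonneg hnonneg]
    rw [e, hstep2]
    refine (Finset.norm_prod_le _ _).trans (Finset.prod_le_prod (fun _ _ => norm_nonneg _) fun q hq => ?_)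
    exact norm_coupledLocalFactor_normWeight_le hσ.le hab hab' m M (hP q hq).one_lt.le
  refine hstep1.trans (hstep3.trans ?_)
  rw [← Real.exp_sum, ← Finset.mul_sum, coupledKernelBound]
  refine Real.exp_le_exp.2 (mul_le_mul_of_nonneg_left ?_ (by positivity))
  exact (summable_rpow_neg_one_add hσ).sum_le_tsum P fun n _ => Real.rpow_nonneg (Nat.cast_nonneg n) _

/-- The coupled terms are absolutely summable. [cite: Maynard2016LargeGaps, §6 (proof of Lemma 6, after (6.9))] -/
theorem summable_norm_coupledEulerTerm {W m : ℕ} (M : ℕ → Finset (ι × κ))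
    {a b : ι → ℂ} {a' b' : κ → ℂ} {σ : ℝ} (hσ : 0 < σ) (hab : ∀ i, σ ≤ (a i).re ∧ σ ≤ (b i).re)
    (hab' : ∀ j, σ ≤ (a' j).re ∧ σ ≤ (b' j).re) :
    Summable fun t => ‖coupledEulerTerm W m M a b a' b' t‖ :=
  summable_of_sum_le (fun _ => norm_nonneg _) (sum_norm_coupledEulerTerm_le M hσ hab hab')

/-- The coupled kernel is the sum of its terms ((6.10) converges absolutely).
[cite: Maynard2016LargeGaps, §6 display (6.10)] -/
theorem hasSum_coupledEulerTerm {W m : ℕ} (M : ℕ → Finset (ι × κ))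
    {a b : ι → ℂ} {a' b' : κ → ℂ} {σ : ℝ} (hσ : 0 < σ) (hab : ∀ i, σ ≤ (a i).re ∧ σ ≤ (b i).re)
    (hab' : ∀ j, σ ≤ (a' j).re ∧ σ ≤ (b' j).re) :
    HasSum (coupledEulerTerm W m M a b a' b') (coupledKernel W m M a b a' b') :=
  (summable_norm_coupledEulerTerm M hσ hab hab').of_norm.hasSum

/-- `‖∑_{t ∈ u} terms‖ ≤ coupledKernelBound` for every finite `u` (the uniform bound behind
"`∏_p K_p ≪ (log x)^{O_k(1)}`"). [cite: Maynard2016LargeGaps, §6 (proof of Lemma 6, after (6.11))] -/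
theorem norm_sum_coupledEulerTerm_le {W m : ℕ} (M : ℕ → Finset (ι × κ))
    {a b : ι → ℂ} {a' b' : κ → ℂ} {σ : ℝ} (hσ : 0 < σ) (hab : ∀ i, σ ≤ (a i).re ∧ σ ≤ (b i).re)
    (hab' : ∀ j, σ ≤ (a' j).re ∧ σ ≤ (b' j).re)
    (u : Finset (((ι → ℕ) × (ι → ℕ)) × ((κ → ℕ) × (κ → ℕ)))) :
    ‖∑ t ∈ u, coupledEulerTerm W m M a b a' b' t‖ ≤
      coupledKernelBound (Fintype.card ι) (Fintype.card κ) σ :=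
  (norm_sum_le _ _).trans (sum_norm_coupledEulerTerm_le M hσ hab hab' u)

/-- **`∏_p K_p ≪ (log x)^{O_k(1)}`** in the form `‖K‖ ≤ coupledKernelBound k₁ k₂ σ`.
[cite: Maynard2016LargeGaps, §6 (proof of Lemma 6, after (6.11))] -/
theorem norm_coupledKernel_le {W m : ℕ} (M : ℕ → Finset (ι × κ))
    {a b : ι → ℂ} {a' b' : κ → ℂ} {σ : ℝ} (hσ : 0 < σ) (hab : ∀ i, σ ≤ (a i).re ∧ σ ≤ (b i).re)
    (hab' : ∀ j, σ ≤ (a' j).re ∧ σ ≤ (b' j).re) :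
    ‖coupledKernel W m M a b a' b'‖ ≤ coupledKernelBound (Fintype.card ι) (Fintype.card κ) σ := by
  rw [coupledKernel]
  refine (norm_tsum_le_tsum_norm (summable_norm_coupledEulerTerm M hσ hab hab')).trans ?_
  exact (summable_norm_coupledEulerTerm M hσ hab hab').tsum_le_of_sum_le
    (sum_norm_coupledEulerTerm_le M hσ hab hab')

/-! ### Box partial sums and prime partial products converge to `K` -/

/-- **The sum over the boxes `[1,D]^{2k₁} × [1,D]^{2k₂}` tends to `K` as `D → ∞`** (the passage
from the finite sum (6.8) to the series (6.10)). [cite: Maynard2016LargeGaps, §6 displays (6.8)–(6.10)] -/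
theorem tendsto_sum_box_coupledEulerTerm {W m : ℕ} (M : ℕ → Finset (ι × κ)) {a b : ι → ℂ}
    {a' b' : κ → ℂ} {σ : ℝ} (hσ : 0 < σ) (hab : ∀ i, σ ≤ (a i).re ∧ σ ≤ (b i).re)
    (hab' : ∀ j, σ ≤ (a' j).re ∧ σ ≤ (b' j).re) :
    Tendsto (fun D : ℕ => ∑ t ∈ (lcmBox ι D ×ˢ lcmBox ι D) ×ˢ (lcmBox κ D ×ˢ lcmBox κ D),
      coupledEulerTerm W m M a b a' b' t) atTop (𝓝 (coupledKernel W m M a b a' b')) := by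
  -- the index set on which the boxes are cofinal
  set S : Set (((ι → ℕ) × (ι → ℕ)) × ((κ → ℕ) × (κ → ℕ))) :=
    {t | (∀ i, 1 ≤ t.1.1 i ∧ 1 ≤ t.1.2 i) ∧ ∀ j, 1 ≤ t.2.1 j ∧ 1 ≤ t.2.2 j} with hSdef
  have hsupp : Function.support (coupledEulerTerm W m M a b a' b') ⊆ S := by
    intro t ht
    obtain ⟨_, hsqD, hsqE⟩ := support_coupledEulerTerm ht
    exact ⟨fun i => ⟨Nat.pos_of_ne_zero (hsqD i).1.ne_zero, Nat.pos_of_ne_zero (hsqD i).2.ne_zero⟩,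
      fun j => ⟨Nat.pos_of_ne_zero (hsqE j).1.ne_zero, Nat.pos_of_ne_zero (hsqE j).2.ne_zero⟩⟩
  have hX : HasSum ((coupledEulerTerm W m M a b a' b') ∘ (↑) : S → ℂ)
      (coupledKernel W m M a b a' b') :=
    (hasSum_subtype_iff_of_support_subset hsupp).2 (hasSum_coupledEulerTerm M hσ hab hab')
  set B : ℕ → Finset S := fun D =>
    ((lcmBox ι D ×ˢ lcmBox ι D) ×ˢ (lcmBox κ D ×ˢ lcmBox κ D)).subtype (· ∈ S) with hBdef
  have hBmono : Monotone B := by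
    intro D D' hDD' t ht
    simp only [hBdef, Finset.mem_subtype, Finset.mem_product, lcmBox, Fintype.mem_piFinset,
      Finset.mem_Icc] at ht ⊢
    exact ⟨⟨fun i => ⟨(ht.1.1 i).1, (ht.1.1 i).2.trans hDD'⟩, fun i => ⟨(ht.1.2 i).1, (ht.1.2 i).2.trans hDD'⟩⟩,
      fun j => ⟨(ht.2.1 j).1, (ht.2.1 j).2.trans hDD'⟩, fun j => ⟨(ht.2.2 j).1, (ht.2.2 j).2.trans hDD'⟩⟩
  have hBcof : ∀ t : S, ∃ D, t ∈ B D := by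
    intro t
    refine ⟨max (Finset.univ.sup fun i => max (t.1.1.1 i) (t.1.1.2 i))
      (Finset.univ.sup fun j => max (t.1.2.1 j) (t.1.2.2 j)), ?_⟩
    have ht : (t : ((ι → ℕ) × (ι → ℕ)) × ((κ → ℕ) × (κ → ℕ))) ∈ S := t.2
    simp only [hSdef, Set.mem_setOf_eq] at ht
    simp only [hBdef, Finset.mem_subtype, Finset.mem_product, lcmBox, Fintype.mem_piFinset,
      Finset.mem_Icc]
    have hle1 : ∀ i, max (t.1.1.1 i) (t.1.1.2 i) ≤ Finset.univ.sup fun i => max (t.1.1.1 i) (t.1.1.2 i) :=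
      fun i => Finset.le_sup (f := fun i => max (t.1.1.1 i) (t.1.1.2 i)) (Finset.mem_univ i)
    have hle2 : ∀ j, max (t.1.2.1 j) (t.1.2.2 j) ≤ Finset.univ.sup fun j => max (t.1.2.1 j) (t.1.2.2 j) :=
      fun j => Finset.le_sup (f := fun j => max (t.1.2.1 j) (t.1.2.2 j)) (Finset.mem_univ j)
    refine ⟨⟨fun i => ⟨(ht.1 i).1, ?_⟩, fun i => ⟨(ht.1 i).2, ?_⟩⟩, fun j => ⟨(ht.2 j).1, ?_⟩,
      fun j => ⟨(ht.2 j).2, ?_⟩⟩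
    · exact ((le_max_left _ _).trans (hle1 i)).trans (le_max_left _ _)
    · exact ((le_max_right _ _).trans (hle1 i)).trans (le_max_left _ _)
    · exact ((le_max_left _ _).trans (hle2 j)).trans (le_max_right _ _)
    · exact ((le_max_right _ _).trans (hle2 j)).trans (le_max_right _ _)
  have hBtend : Tendsto B atTop atTop := tendsto_atTop_finset_of_monotone hBmono hBcof
  have hX' : Tendsto (fun s : Finset S => ∑ y ∈ s, ((coupledEulerTerm W m M a b a' b') ∘ (↑)) y)
      atTop (𝓝 (coupledKernel W m M a b a' b')) := by
    have := hX
    rw [HasSum] at this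
    simpa only [SummationFilter.unconditional_filter] using this
  have key := hX'.comp hBtend
  refine key.congr fun D => ?_
  simp only [Function.comp_def, hBdef]
  rw [Finset.sum_subtype_eq_sum_filter, Finset.filter_true_of_mem]
  intro t ht
  simp only [Finset.mem_product, lcmBox, Fintype.mem_piFinset, Finset.mem_Icc] at ht
  exact ⟨fun i => ⟨(ht.1.1 i).1, (ht.1.2 i).1⟩, fun j => ⟨(ht.2.1 j).1, (ht.2.2 j).1⟩⟩

/-- **`K = ∏_p K_p`**: the Euler products over the primes `p < N`, `p ∤ W` tend to `K` ("we can
rewrite the sum as a product `∏_p K_p`", p. 10). [cite: Maynard2016LargeGaps, §6 display (6.11)] -/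
theorem tendsto_prod_coupledLocalFactorMu {W m : ℕ} (M : ℕ → Finset (ι × κ)) {a b : ι → ℂ}
    {a' b' : κ → ℂ} {σ : ℝ} (hσ : 0 < σ) (hab : ∀ i, σ ≤ (a i).re ∧ σ ≤ (b i).re)
    (hab' : ∀ j, σ ≤ (a' j).re ∧ σ ≤ (b' j).re) :
    Tendsto (fun N : ℕ => ∏ q ∈ primesBelowNotDvd W N, coupledLocalFactorMu m M a b a' b' q) atTop
      (𝓝 (coupledKernel W m M a b a' b')) := by
  set S : Set (((ι → ℕ) × (ι → ℕ)) × ((κ → ℕ) × (κ → ℕ))) :=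
    {t | GoodPair W t.1 ∧ GoodPair W t.2} with hSdef
  have hsupp : Function.support (coupledEulerTerm W m M a b a' b') ⊆ S :=
    fun t ht => goodPair_of_coupledEulerTerm_ne_zero ht
  have hX : HasSum ((coupledEulerTerm W m M a b a' b') ∘ (↑) : S → ℂ)
      (coupledKernel W m M a b a' b') :=
    (hasSum_subtype_iff_of_support_subset hsupp).2 (hasSum_coupledEulerTerm M hσ hab hab')
  set B : ℕ → Finset S := fun N =>
    (pairBox ι (primesBelowNotDvd W N) ×ˢ pairBox κ (primesBelowNotDvd W N)).subtype (· ∈ S)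
    with hBdef
  have hBmono : Monotone B := by
    intro N N' hNN' t ht
    simp only [hBdef, Finset.mem_subtype] at ht ⊢
    have hsub : primesBelowNotDvd W N ⊆ primesBelowNotDvd W N' := primesBelowNotDvd_mono W hNN'
    have hdvd : (∏ q ∈ primesBelowNotDvd W N, q) ∣ ∏ q ∈ primesBelowNotDvd W N', q :=
      Finset.prod_dvd_prod_of_subset _ _ _ hsub
    have hne : (∏ q ∈ primesBelowNotDvd W N', q) ≠ 0 :=
      Finset.prod_ne_zero_iff.2 fun q hq => (prime_of_mem_primesBelowNotDvd hq).ne_zero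
    simp only [pairBox, Finset.mem_product, Fintype.mem_piFinset, Nat.mem_divisors] at ht ⊢
    exact ⟨⟨fun i => ⟨(ht.1.1 i).1.trans hdvd, hne⟩, fun i => ⟨(ht.1.2 i).1.trans hdvd, hne⟩⟩,
      fun j => ⟨(ht.2.1 j).1.trans hdvd, hne⟩, fun j => ⟨(ht.2.2 j).1.trans hdvd, hne⟩⟩
  have hBcof : ∀ t : S, ∃ N, t ∈ B N := by
    intro t
    have ht : (t : ((ι → ℕ) × (ι → ℕ)) × ((κ → ℕ) × (κ → ℕ))) ∈ S := t.2
    simp only [hSdef, Set.mem_setOf_eq] at ht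
    refine ⟨max (Finset.univ.sup fun i => max (t.1.1.1 i) (t.1.1.2 i))
      (Finset.univ.sup fun j => max (t.1.2.1 j) (t.1.2.2 j)) + 1, ?_⟩
    simp only [hBdef, Finset.mem_subtype, Finset.mem_product]
    have hle1 : ∀ i, max (t.1.1.1 i) (t.1.1.2 i) ≤ Finset.univ.sup fun i => max (t.1.1.1 i) (t.1.1.2 i) :=
      fun i => Finset.le_sup (f := fun i => max (t.1.1.1 i) (t.1.1.2 i)) (Finset.mem_univ i)
    have hle2 : ∀ j, max (t.1.2.1 j) (t.1.2.2 j) ≤ Finset.univ.sup fun j => max (t.1.2.1 j) (t.1.2.2 j) :=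
      fun j => Finset.le_sup (f := fun j => max (t.1.2.1 j) (t.1.2.2 j)) (Finset.mem_univ j)
    refine ⟨mem_pairBox_of_goodPair ht.1 fun i => ?_, mem_pairBox_of_goodPair ht.2 fun j => ?_⟩
    · have := hle1 i
      have h2 := le_max_left (Finset.univ.sup fun i => max (t.1.1.1 i) (t.1.1.2 i))
        (Finset.univ.sup fun j => max (t.1.2.1 j) (t.1.2.2 j))
      constructor <;> omega
    · have := hle2 j
      have h2 := le_max_right (Finset.univ.sup fun i => max (t.1.1.1 i) (t.1.1.2 i))
        (Finset.univ.sup fun j => max (t.1.2.1 j) (t.1.2.2 j))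
      constructor <;> omega
  have hBtend : Tendsto B atTop atTop := tendsto_atTop_finset_of_monotone hBmono hBcof
  have hX' : Tendsto (fun s : Finset S => ∑ y ∈ s, ((coupledEulerTerm W m M a b a' b') ∘ (↑)) y)
      atTop (𝓝 (coupledKernel W m M a b a' b')) := by
    have := hX
    rw [HasSum] at this
    simpa only [SummationFilter.unconditional_filter] using this
  have key := hX'.comp hBtend
  refine key.congr fun N => ?_
  simp only [Function.comp_def, hBdef]
  rw [Finset.sum_subtype_eq_sum_filter, Finset.filter_true_of_mem (fun t ht => ?_)]
  · rw [Finset.sum_product]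
    exact sum_pairBox_coupledEulerTerm (fun q hq => prime_of_mem_primesBelowNotDvd hq)
      (fun q hq => not_dvd_of_mem_primesBelowNotDvd hq) m M a b a' b'
  · obtain ⟨h1, h2⟩ := Finset.mem_product.1 ht
    exact ⟨goodPair_of_mem_pairBox h1, goodPair_of_mem_pairBox h2⟩

end LcmEuler

end Literature.NumberTheory.Sieve
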